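/-
Copyright: H21 K2-LIT squad (hodgecm-mathlib). Helper for crux hLiu418 = `stmt-HodgeConjecture-24832`
(route `route-HodgeConjecture-HCCMUnconditional`), G1 road (★ `K2LiuContinuationLieDerivative`).
-/
import Literature.NumberTheory.GelbartRogawski1991.DoubledUnitaryGlobalSplittingData   -- the #41 frame: `HA`, `hermD`, `Fp`
import Summits.HodgeConjecture.HodgeConjecture.Theorems.K2LiuArchOneParameterOrbitDefs    -- `archExp` and its one-parameter algebra
import Literature.NumberTheory.Automorphic.AdelicHeightGLProofs                      -- ★ `adelicHeightGL_mul_le_holds`, `adelicHeightGL_pos_holds`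
import Literature.NumberTheory.Automorphic.HarishChandraGrowthGL                     -- ★ `continuous_adelicHeightGL_ofInfinite`
import Mathlib.Topology.Order.Compact
import HarnessLib

/-!
# Heights along archimedean one-parameter orbits `t ↦ h₀ · ι_∞(exp tX)`

The G1 engine ★ `K2LiuContinuationLieDerivative.hasDerivAt_continuation_orbit` (and its residue / termwise companions
★ `K2LiuResidueLieDerivative`, ★ `K2LiuEisensteinTermwiseLieDerivative`) differentiates a continued family along an orbit
`γ : ℝ → H(𝔸)` under two hypotheses on the orbit only:

* `hγc : Continuous γ`;
* `hγ : ∀ R, ∃ B₁ B₂, 0 < B₁ ∧ ∀ t, |t| ≤ R → B₁ ≤ ‖γ t‖ ∧ ‖γ t‖ ≤ B₂` (`‖·‖ = adelicHeightGL`).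

This file discharges both for the orbits that actually occur, `γ t = h₀ · ι_∞(exp tX)` with `h₀ ∈ H(𝔸)` and `X` in the real
Lie algebra `𝔲 = archSkew` of `H_∞ = U(J)(E ⊗ ℝ)` (★ `UnitaryGroup.archSkew`, `expGL_smul_mem_arch`), in three layers:

1. pure height algebra on `GL_n(𝔸_K)`: a constant `C > 0` with `‖g h‖ ≤ C ‖g‖ ‖h‖` **and** `‖g‖ ≤ C ‖g h‖ ‖h‖`
   (★ `adelicHeightGL_mul_le_holds` + `‖h⁻¹‖ = ‖h‖`), hence two-sided segment bounds for `t ↦ g · k t` from those of `k`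
   (`n ≥ 1`, ★ `adelicHeightGL_pos_holds`);
2. two-sided segment bounds for `t ↦ ι_∞(k t)`, `k : ℝ → GL_N(E ⊗ ℝ)` continuous — the height `x ↦ ‖(x, 1)‖` is continuous
   (★ `continuous_adelicHeightGL_ofInfinite`) and positive, so it attains a positive minimum and a maximum on `k([-R, R])`;
3. the frame instance: for `X ∈ 𝔲` and `h₀ ∈ H(𝔸)` the orbit `γ_X(t) = h₀ · archExp … hX t` (`archExp hX t = ι_∞(exp tX)`, the
   subgroup-typed one-parameter orbit of `K2LiuArchOneParameterOrbitDefs`) in `HA L e dV hdV dW hdW` is continuous and satisfies `hγ` verbatim.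

[cite: BorelJacquet1979, §1.2 (properties of the height ‖g‖), §4.1 (the archimedean component)]
[cite: MoeglinWaldspurger1995, I.2.2 (heights), IV.1.9 (derivatives of holomorphic families in the group variable)]
-/

set_option linter.dupNamespace false -- the mandated namespace repeats `HodgeConjecture.HodgeConjecture`

open Literature.NumberTheory.Automorphic Literature.NumberTheory.Automorphic.UnitaryGroup
open Literature.NumberTheory.GaloisRepresentations
open Literature.NumberTheory.GelbartRogawski1991 Literature.NumberTheory.GelbartRogawski1991.GRConstruction
-- `Classical` is needed to see the Mathlib normed-ring instances on `mixedSpace E` (note H5 of `AdelicGLnGlue`)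
open scoped Classical
open NumberField NumberField.mixedEmbedding IsDedekindDomain Set
open scoped Topology

namespace Summit.HodgeConjecture.HodgeConjecture.Cruxes.HLiu418.K2LiuArchOneParameterOrbitHeight

open Summit.HodgeConjecture.HodgeConjecture.Cruxes.HLiu418.K2LiuArchOneParameterOrbitDefs

/-! ## 1. Height algebra on `GL_n(𝔸_K)` -/

section HeightAlgebra

variable {n : ℕ} {K : Type} [Field K] [NumberField K]

/-- **two-sided submultiplicativity**: one constant `C > 0` with `‖g h‖ ≤ C ‖g‖ ‖h‖` and `‖g‖ ≤ C ‖g h‖ ‖h‖` for all `g h`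
(the second from the first applied to `(g h) · h⁻¹` and `‖h⁻¹‖ = ‖h‖`). [cite: BorelJacquet1979, §1.2 (property (ii))] -/
theorem exists_pos_height_mul_le :
    ∃ C : ℝ, 0 < C ∧ ∀ g h : GL (Fin n) (AdeleRing (𝓞 K) K),
      adelicHeightGL n K (g * h) ≤ C * adelicHeightGL n K g * adelicHeightGL n K h ∧
        adelicHeightGL n K g ≤ C * adelicHeightGL n K (g * h) * adelicHeightGL n K h := by
  obtain ⟨C, hC⟩ := adelicHeightGL_mul_le_holds (n := n) (K := K)
  refine ⟨max C 1, lt_of_lt_of_le one_pos (le_max_right _ _), fun g h => ⟨?_, ?_⟩⟩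
  · calc adelicHeightGL n K (g * h) ≤ C * adelicHeightGL n K g * adelicHeightGL n K h := hC g h
      _ ≤ max C 1 * adelicHeightGL n K g * adelicHeightGL n K h := by
        have h0 : 0 ≤ adelicHeightGL n K g * adelicHeightGL n K h :=
          mul_nonneg (adelicHeightGL_nonneg _) (adelicHeightGL_nonneg _)
        nlinarith [le_max_left C 1]
  · have h1 : adelicHeightGL n K g = adelicHeightGL n K (g * h * h⁻¹) := by rw [mul_inv_cancel_right]
    calc adelicHeightGL n K g = adelicHeightGL n K (g * h * h⁻¹) := h1
      _ ≤ C * adelicHeightGL n K (g * h) * adelicHeightGL n K h⁻¹ := hC _ _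
      _ = C * adelicHeightGL n K (g * h) * adelicHeightGL n K h := by rw [adelicHeightGL_inv]
      _ ≤ max C 1 * adelicHeightGL n K (g * h) * adelicHeightGL n K h := by
        have h0 : 0 ≤ adelicHeightGL n K (g * h) * adelicHeightGL n K h :=
          mul_nonneg (adelicHeightGL_nonneg _) (adelicHeightGL_nonneg _)
        nlinarith [le_max_left C 1]

/-- **left translates keep two-sided segment bounds** (`n ≥ 1`): if `‖k t‖ ∈ [B₁, B₂]` with `B₁ > 0` for `|t| ≤ R`, then
`‖g · k t‖ ∈ [B₁', B₂']` with `B₁' > 0` for `|t| ≤ R` (`B₁' = ‖g‖ / (C (B₂ ⊔ 1))`, `B₂' = C ‖g‖ (B₂ ⊔ 1)`).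
[cite: BorelJacquet1979, §1.2 (properties (i), (ii))] -/
theorem exists_height_bounds_mul [NeZero n] (g : GL (Fin n) (AdeleRing (𝓞 K) K))
    (k : ℝ → GL (Fin n) (AdeleRing (𝓞 K) K))
    (hk : ∀ R : ℝ, ∃ B₁ B₂ : ℝ, 0 < B₁ ∧ ∀ t : ℝ, |t| ≤ R →
      B₁ ≤ adelicHeightGL n K (k t) ∧ adelicHeightGL n K (k t) ≤ B₂) (R : ℝ) :
    ∃ B₁ B₂ : ℝ, 0 < B₁ ∧ ∀ t : ℝ, |t| ≤ R →
      B₁ ≤ adelicHeightGL n K (g * k t) ∧ adelicHeightGL n K (g * k t) ≤ B₂ := by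
  obtain ⟨C, hC0, hC⟩ := exists_pos_height_mul_le (n := n) (K := K)
  obtain ⟨B₁, B₂, hB₁, hB⟩ := hk R
  have hg : 0 < adelicHeightGL n K g := adelicHeightGL_pos_holds g
  have hB₂' : 0 < max B₂ 1 := lt_of_lt_of_le one_pos (le_max_right _ _)
  refine ⟨adelicHeightGL n K g / (C * max B₂ 1), C * adelicHeightGL n K g * max B₂ 1, div_pos hg (mul_pos hC0 hB₂'),
    fun t ht => ⟨?_, ?_⟩⟩
  · rw [div_le_iff₀ (mul_pos hC0 hB₂')]
    have h1 := (hC g (k t)).2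
    have h2 : adelicHeightGL n K (k t) ≤ max B₂ 1 := (hB t ht).2.trans (le_max_left _ _)
    have h3 : 0 ≤ C * adelicHeightGL n K (g * k t) := mul_nonneg hC0.le (adelicHeightGL_nonneg _)
    nlinarith
  · have h1 := (hC g (k t)).1
    have h2 : adelicHeightGL n K (k t) ≤ max B₂ 1 := (hB t ht).2.trans (le_max_left _ _)
    have h3 : 0 ≤ C * adelicHeightGL n K g := mul_nonneg hC0.le (adelicHeightGL_nonneg _)
    nlinarith

/-- **two-sided segment bounds for a continuous archimedean family**: for `k : ℝ → GL_n(K ⊗ ℝ)` continuous and `n ≥ 1`, the height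
of `ι_∞(k t) = (k t, 1)` stays in some `[B₁, B₂]`, `B₁ > 0`, for `|t| ≤ R` — `x ↦ ‖(x, 1)‖` is continuous and positive, so it attains a
positive minimum and is bounded on the compact `k([-R, R])`. [cite: BorelJacquet1979, §1.2, §4.1] -/
theorem exists_height_bounds_ofInfinite [NeZero n] (k : ℝ → GL (Fin n) (mixedSpace K)) (hk : Continuous k) (R : ℝ) :
    ∃ B₁ B₂ : ℝ, 0 < B₁ ∧ ∀ t : ℝ, |t| ≤ R →
      B₁ ≤ adelicHeightGL n K (GLn.ofInfinite n K (k t)) ∧ adelicHeightGL n K (GLn.ofInfinite n K (k t)) ≤ B₂ := by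
  have hc : Continuous fun t : ℝ => adelicHeightGL n K (GLn.ofInfinite n K (k t)) :=
    continuous_adelicHeightGL_ofInfinite.comp hk
  obtain ⟨B₂, -, hB₂⟩ := exists_adelicHeightGL_ofInfinite_le_of_isCompact (K := K)
    ((isCompact_Icc (a := -R) (b := R)).image hk)
  rcases lt_or_ge R 0 with hR | hR
  · exact ⟨1, B₂, one_pos, fun t ht => absurd (abs_nonneg t) (not_le.2 (ht.trans_lt hR))⟩
  · obtain ⟨t₀, ht₀, hmin⟩ := (isCompact_Icc (a := -R) (b := R)).exists_isMinOn
      (nonempty_Icc.2 (by linarith)) hc.continuousOn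
    refine ⟨adelicHeightGL n K (GLn.ofInfinite n K (k t₀)), B₂, adelicHeightGL_pos_holds _, fun t ht => ?_⟩
    have htI : t ∈ Icc (-R) R := ⟨(abs_le.1 ht).1, (abs_le.1 ht).2⟩
    exact ⟨hmin htI, hB₂ _ (mem_image_of_mem k htI)⟩

end HeightAlgebra

/-! ## 2. Archimedean one-parameter orbits in `U(J)(𝔸_F)` -/

section Arch

variable (F E : Type) [Field F] [Field E] [NumberField E] [Algebra F E] (c : E ≃ₐ[F] E) (N : ℕ) (J : Matrix (Fin N) (Fin N) E)

/-- **two-sided segment height bounds along `t ↦ h₀ · (k t, 1)`** for any continuous `k : ℝ → U(J)(E ⊗ ℝ)` and `h₀ ∈ U(J)(𝔸_F)` (`N ≥ 1`):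
`∀ R, ∃ B₁ B₂, 0 < B₁ ∧ ∀ |t| ≤ R, B₁ ≤ ‖h₀ (k t, 1)‖ ≤ B₂`. [cite: BorelJacquet1979, §1.2, §4.1] -/
theorem exists_height_bounds_mul_ofInfinite [NeZero N] (h₀ : adelic F E c N J) (k : ℝ → arch F E c N J) (hk : Continuous k) (R : ℝ) :
    ∃ B₁ B₂ : ℝ, 0 < B₁ ∧ ∀ t : ℝ, |t| ≤ R →
      B₁ ≤ adelicHeightGL N E ((h₀ : GL (Fin N) (AdeleRing (𝓞 E) E)) * GLn.ofInfinite N E (k t : GL (Fin N) (mixedSpace E))) ∧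
        adelicHeightGL N E ((h₀ : GL (Fin N) (AdeleRing (𝓞 E) E)) * GLn.ofInfinite N E (k t : GL (Fin N) (mixedSpace E))) ≤ B₂ :=
  exists_height_bounds_mul (h₀ : GL (Fin N) (AdeleRing (𝓞 E) E)) (fun t => GLn.ofInfinite N E (k t : GL (Fin N) (mixedSpace E)))
    (exists_height_bounds_ofInfinite (fun t => (k t : GL (Fin N) (mixedSpace E))) (continuous_subtype_val.comp hk)) R

/-- **two-sided segment height bounds along the orbit `t ↦ h₀ · archExp hX t = h₀ · (exp tX, 1)`** (`X ∈ 𝔲`, `h₀ ∈ U(J)(𝔸_F)`, `N ≥ 1`).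
[cite: BorelJacquet1979, §1.2, §4.1] [cite: MoeglinWaldspurger1995, I.2.2] -/
theorem exists_height_bounds_mul_archExp [NeZero N] (h₀ : adelic F E c N J) {X : Matrix (Fin N) (Fin N) (mixedSpace E)}
    (hX : X ∈ archSkew F E c N J) (R : ℝ) :
    ∃ B₁ B₂ : ℝ, 0 < B₁ ∧ ∀ t : ℝ, |t| ≤ R →
      B₁ ≤ adelicHeightGL N E ((h₀ * archExp F E c N J hX t : adelic F E c N J) : GL (Fin N) (AdeleRing (𝓞 E) E)) ∧
        adelicHeightGL N E ((h₀ * archExp F E c N J hX t : adelic F E c N J) : GL (Fin N) (AdeleRing (𝓞 E) E)) ≤ B₂ :=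
  exists_height_bounds_mul (h₀ : GL (Fin N) (AdeleRing (𝓞 E) E)) (fun t => GLn.ofInfinite N E (expGL (t • X)))
    (exists_height_bounds_ofInfinite (fun t => expGL (t • X)) (continuous_expGL_smul X)) R

end Arch

/-! ## 3. The frame instance: orbits in `H(𝔸) = HA L e dV hdV dW hdW` -/

section Frame

variable (L : Type) [Field L] [NumberField L] [IsCMField L]
variable {N M n : ℕ} (e : Fin N × Fin M ≃ Fin n)
  (dV : Fin N → L) (hdV : ∀ i, IsCMField.complexConj L (dV i) = dV i)
  (dW : Fin M → L) (hdW : ∀ i, IsCMField.complexConj L (dW i) = dW i)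

/-- **the orbit `γ_X(t) = h₀ · archExp hX t = h₀ · ι_∞(exp tX)` in `H(𝔸)` is continuous** (`h₀ ∈ H(𝔸) = HA L e dV hdV dW hdW`,
`X ∈ 𝔥_∞ = archSkew … (hermD …)`) — the hypothesis `hγc` of ★ `K2LiuContinuationLieDerivative.hasDerivAt_continuation_orbit`.
[cite: BorelJacquet1979, §4.1] -/
theorem continuous_archOrbit (h₀ : HA L e dV hdV dW hdW) {X : Matrix (Fin (n + n)) (Fin (n + n)) (mixedSpace L)}
    (hX : X ∈ archSkew (Fp L) L (IsCMField.complexConj L) (n + n) (hermD L e dV hdV dW hdW)) :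
    Continuous fun t : ℝ =>
      (h₀ * archExp (Fp L) L (IsCMField.complexConj L) (n + n) (hermD L e dV hdV dW hdW) hX t : HA L e dV hdV dW hdW) :=
  continuous_mul_archExp (Fp L) L (IsCMField.complexConj L) (n + n) (hermD L e dV hdV dW hdW) hX h₀

/-- **two-sided segment height bounds along `γ_X(t) = h₀ · archExp hX t`** (`n ≥ 1`): for every `R` there are `0 < B₁` and `B₂` with
`B₁ ≤ ‖γ_X(t)‖ ≤ B₂` for `|t| ≤ R` — verbatim the hypothesis `hγ` of ★ `K2LiuContinuationLieDerivative.hasDerivAt_continuation_orbit`,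
★ `K2LiuResidueLieDerivative.hasDerivAt_resNorm_orbit`, ★ `K2LiuEisensteinTermwiseLieDerivative.hasDerivAt_continuation_orbit_of_termwise`
(with `γ := fun t => h₀ * archExp … hX t`). [cite: BorelJacquet1979, §1.2, §4.1] [cite: MoeglinWaldspurger1995, I.2.2] -/
theorem exists_height_bounds_archOrbit (hn : 0 < n) (h₀ : HA L e dV hdV dW hdW)
    {X : Matrix (Fin (n + n)) (Fin (n + n)) (mixedSpace L)}
    (hX : X ∈ archSkew (Fp L) L (IsCMField.complexConj L) (n + n) (hermD L e dV hdV dW hdW)) (R : ℝ) :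
    ∃ B₁ B₂ : ℝ, 0 < B₁ ∧ ∀ t : ℝ, |t| ≤ R →
      B₁ ≤ adelicHeightGL (n + n) L
          ((h₀ * archExp (Fp L) L (IsCMField.complexConj L) (n + n) (hermD L e dV hdV dW hdW) hX t : HA L e dV hdV dW hdW) :
            GL (Fin (n + n)) (AdeleRing (𝓞 L) L)) ∧
        adelicHeightGL (n + n) L
          ((h₀ * archExp (Fp L) L (IsCMField.complexConj L) (n + n) (hermD L e dV hdV dW hdW) hX t : HA L e dV hdV dW hdW) :
            GL (Fin (n + n)) (AdeleRing (𝓞 L) L)) ≤ B₂ := by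
  haveI : NeZero (n + n) := ⟨by omega⟩
  exact exists_height_bounds_mul_archExp (Fp L) L (IsCMField.complexConj L) (n + n) (hermD L e dV hdV dW hdW) h₀ hX R

/-- **two-sided segment height bounds along `t ↦ h₀ · ι_∞(k t)` for any continuous `k : ℝ → H_∞`** (`n ≥ 1`; e.g. products of
one-parameter subgroups, or `K_∞`-valued paths), at the `GL_{2n}(𝔸_L)` level. [cite: BorelJacquet1979, §1.2, §4.1] -/
theorem exists_height_bounds_mul_arch (hn : 0 < n) (h₀ : HA L e dV hdV dW hdW)
    (k : ℝ → arch (Fp L) L (IsCMField.complexConj L) (n + n) (hermD L e dV hdV dW hdW)) (hk : Continuous k) (R : ℝ) :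
    ∃ B₁ B₂ : ℝ, 0 < B₁ ∧ ∀ t : ℝ, |t| ≤ R →
      B₁ ≤ adelicHeightGL (n + n) L ((h₀ : GL (Fin (n + n)) (AdeleRing (𝓞 L) L)) *
          GLn.ofInfinite (n + n) L (k t : GL (Fin (n + n)) (mixedSpace L))) ∧
        adelicHeightGL (n + n) L ((h₀ : GL (Fin (n + n)) (AdeleRing (𝓞 L) L)) *
          GLn.ofInfinite (n + n) L (k t : GL (Fin (n + n)) (mixedSpace L))) ≤ B₂ := by
  haveI : NeZero (n + n) := ⟨by omega⟩
  exact exists_height_bounds_mul_ofInfinite (Fp L) L (IsCMField.complexConj L) (n + n) (hermD L e dV hdV dW hdW) h₀ k hk R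

end Frame

end Summit.HodgeConjecture.HodgeConjecture.Cruxes.HLiu418.K2LiuArchOneParameterOrbitHeight
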